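import Summits.HodgeConjecture.HodgeConjecture.Theorems.PadicSemiregularLiftAnchorsAtGenericHodgeLocusPointsFermatLiftModel
import Summits.HodgeConjecture.HodgeConjecture.Theorems.PadicSemiregularLiftAnchorsAtGenericHodgeLocusPointsComplexEmbedding
import HarnessLib

/-!
# The Fermat anchor of a COMPLEX Fermat variety (helper for `AnchorsAtGenericHodgeLocusPoints`, stmt-HodgeConjecture-13944)

Route `PadicSemiregularLift` of `HodgeConjecture`, item P2b, Fermat half (B2), geometric clauses for a complex
Fermat variety `Y = Xⁿₘ`: an anchor prime `p ≡ -1 (mod m)`, `p > n + 6` (`…FermatPrimes`), the smooth proper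
Fermat lift `𝒳 / W(𝔽̄_p)` with Fermat fibres (`…FermatLiftModel.exists_fermat_anchor_model`), a ring embedding
`ι : K = W(𝔽̄_p)[1/p] → ℂ` (`…ComplexEmbedding`), and `Y ≅ 𝒳_K ⊗_{K,ι} ℂ` (two complex Fermat varieties `Xⁿₘ`
are isomorphic, `IsFermatVariety.nonempty_iso`) — i.e. the geometric fields of
`Crystalline.PadicAnchor.PadicModel n Y` for Fermat anchors, unconditionally.

References: T. Shioda, T. Katsura, *On Fermat varieties*, Tôhoku Math. J. 31 (1979) §3 [ShiodaKatsura1979];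
R. Hartshorne, *Algebraic Geometry* (1977), III Thm. 10.2 [Hartshorne1977].
-/

-- the summit-side namespace `Summit.HodgeConjecture.HodgeConjecture.…` (summit = sub-problem, D-0017)
-- repeats a component by design; the linter would flag every declaration.
set_option linter.dupNamespace false

noncomputable section

open CategoryTheory AlgebraicGeometry MvPolynomial
open scoped Isocrystal
open Literature.AlgebraicGeometry.Motives Literature.AlgebraicGeometry.Motives.WittScheme
  Literature.AlgebraicGeometry.Crystalline

namespace Summit.HodgeConjecture.HodgeConjecture.Theorems.AnchorsAtGenericHodgeLocusPoints

/-- **(B2), geometric half, for a COMPLEX Fermat variety.** For every complex Fermat variety `Y = Xⁿₘ`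
(`Motives.IsFermatVariety n m Y`, `n ≥ 1`, `m ≥ 3`) there are an anchor prime `p` (`p > n + 6`,
`p ≡ -1 (mod m)`, `m ∣ p + 1`, `p ∤ m`), a Fermat lift `𝒳` over `W(𝔽̄_p)` — reduced smooth proper model of
relative dimension `n`, projective over `W(𝔽̄_p)`, special fibre the Fermat variety `Xⁿₘ ⊗ 𝔽̄_p` — and a
ring embedding `ι : K = W(𝔽̄_p)[1/p] → ℂ` (`…ComplexEmbedding`) with `Y ≅ 𝒳_K ⊗_{K,ι} ℂ` over `ℂ`
(two Fermat varieties `Xⁿₘ` over `ℂ` are isomorphic, `IsFermatVariety.nonempty_iso`): verbatim the geometric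
fields `p, large, k, 𝒴, model, ι, iso` of `Crystalline.PadicAnchor.PadicModel n Y` (whose remaining field, a
supersingular ABELIAN special fibre, is the abelian-type clause and does not concern Fermat anchors) and the
clauses "𝒳 = Xⁿₘ over W(𝔽̄_p) …, (ii) smooth hypersurface …, 𝒳_K ⊗_{K,ι} ℂ ≅ Y" of (B2).
[cite: ShiodaKatsura1979, §3] [cite: Hartshorne1977, III Thm. 10.2] -/
theorem exists_fermat_anchor_model_complex {n m : ℕ} (hn : 1 ≤ n) (hm : 3 ≤ m) (Y : SchemeOver ℂ)
    (hY : IsFermatVariety n m Y) :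
    ∃ p : ℕ, ∃ _ : Fact p.Prime, n + 6 < p ∧ (p : ZMod m) = -1 ∧ m ∣ p + 1 ∧ ¬ p ∣ m ∧
      ∃ (𝒳 : SchemeOver (WittVector p (AlgebraicClosure (ZMod p))))
        (ι : K(p, AlgebraicClosure (ZMod p)) →+* ℂ),
        (letI := MvPolynomial.gradedAlgebra (σ := Fin (n + 2)) (R := WittVector p (AlgebraicClosure (ZMod p)))
          ∃ j : 𝒳 ⟶ projectiveSpaceOver (n + 1) (WittVector p (AlgebraicClosure (ZMod p))),
            IsClosedImmersion j.left ∧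
            Set.range j.left.base =
              ProjectiveSpectrum.zeroLocus
                (homogeneousSubmodule (Fin (n + 2)) (WittVector p (AlgebraicClosure (ZMod p))))
                {∑ i : Fin (n + 2),
                  (X i : MvPolynomial (Fin (n + 2)) (WittVector p (AlgebraicClosure (ZMod p)))) ^ m}) ∧
        IsProjectiveOverRing 𝒳 ∧ IsReduced 𝒳.left ∧ IsSmoothProperModel n 𝒳 ∧
        IsFermatVariety n m (specialFibre 𝒳) ∧ IsFermatVariety n m (genericFibre 𝒳) ∧
        Nonempty (Y ≅ (baseChangeHom ι).obj (genericFibre 𝒳)) := by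
  obtain ⟨p, hp, hpn, h, hdvd, hpm, 𝒳, hF, hproj, hred, hmodel, hs, hg, hL⟩ :=
    exists_fermat_anchor_model n m hn hm
  obtain ⟨ι⟩ := nonempty_ringHom_fractionRing_wittVector_algebraicClosure_complex p
  exact ⟨p, hp, hpn, h, hdvd, hpm, 𝒳, ι, hF, hproj, hred, hmodel, hs, hg, hY.nonempty_iso (hL ℂ ι)⟩

end Summit.HodgeConjecture.HodgeConjecture.Theorems.AnchorsAtGenericHodgeLocusPoints

end
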